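import Summits.CriticalPhenomena.PercolationContinuityZ3.Theorems.Transplant.FKConnectivityAllQApexHubForms2
import Summits.CriticalPhenomena.PercolationContinuityZ3.Theorems.Transplant.FKConnectivityAllQApexHubThreeAlg
import HarnessLib

/-!
# Connectivity correlation inequalities for `φ_{w,q}`, every `q > 0` — the HUB INEQUALITY AT AN APEX, file 5g:
# THREE apex terminals — Ayyer–Linusson–Ravichandran's (13)/(14) at `(y; x; z)` for apexes `x, y, z` over `(u, v)` in an ARBITRARY
# weighted graph, every `0 < q ≤ 1` (the all-leaf triples of the double cones `K_{2,m}`, `K_{1,1,m}`)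

Support file (`--supports stmt-CriticalPhenomena-4575`), census seat `prim-bschramm-census` (gen 22) of the post-continuity
programme; builds on p205010 (kernel theorem, internal audit signed; external expert review pending).  No definitions, no named
facts, no sorries; standard axioms.

**`hubUnder_apex_three`**: for `u ≠ v` and three distinct apexes `x, y, z ∉ {u, v}` over `(u, v)` (every live pair at each of them goes
to `u` or `v`; the rest of the weighted graph is arbitrary), `φ_{w,q}(y ↔ x)·φ_{w,q}(z ↔ x) ≤ φ_{w,q}(y ↔ x ↔ z)` for all `0 < q ≤ 1`.
This is the one triple type of a double cone NOT reachable from the tree's series–parallel theorems (both hub pairs `xy`, `xz` are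
non-edges and adjoining them creates a `K₄` minor), and it completes the hub inequality AT EVERY TRIPLE of every weighted `K_{2,m}` /
`K_{1,1,m}` (`…ApexHubOne/Two.lean` for the other four triple types).  PROOF: peel `x` (table lemma; auxiliary events read off
`ω ∖ {ux, xv}`), then `y` (level-two dictionary `…ApexHubForms2.lean` and level one `…ApexHubForms.lean` under `w[ux,xv ↦ 0]`), then `z`
(level one under `w[ux,xv,uy,yv ↦ 0]`); the resulting polynomial inequality in the twelve leaf-type weights, `s = q⁻¹ − 1` and the two
base masses is `apexThree_alg` (certificate with 1271 nonnegative terms modulo the three leaf relations; files 5a–5e).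
[cite: AyyerLinussonRavichandran2025, §7 eq. (13)–(15), Conj. 7.1 (p. 22)] [cite: Grimmett2006, Thm. (3.1)(a) (p. 37); §1.4 eq. (1.20) (p. 15); §3.9 (p. 63)]
-/

noncomputable section

namespace Summit.CriticalPhenomena.PercolationContinuityZ3.Theorems

namespace FK

open MeasureTheory Set Literature.Probability.LatticeModels Literature.Probability.Percolation
open Literature.Probability.Percolation.DecisionTree (ind ind_of_mem ind_of_not_mem ind_nonneg)
open Literature.Probability.Percolation.TwoAvoidanceSets (ind_mul_ind)
open scoped Classical symmDiff

variable {V : Type*} [Fintype V]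

omit [Fintype V] in
/-- Connection to the apex through its two pairs: for an apex `x` over `(u,v)` and `t ≠ x`,
`t ↔ x` iff (`ux` open and `u ↔ t` avoiding the apex pairs) or (`xv` open and `v ↔ t` avoiding them). [folklore] -/
theorem mem_openConn_apex_iff {ω : BondConfig V} {u v x t : V} (hxv : x ≠ v) (hxt : x ≠ t)
    (hω : ∀ e ∈ ω, x ∈ e → e = s(u, x) ∨ e = s(x, v)) :
    ω ∈ (openConn t x : Set (BondConfig V)) ↔
      (s(u, x) ∈ ω ∧ ω \ {s(u, x), s(x, v)} ∈ (openConn u t : Set (BondConfig V))) ∨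
        (s(x, v) ∈ ω ∧ ω \ {s(u, x), s(x, v)} ∈ (openConn v t : Set (BondConfig V))) := by
  rw [mem_openConn_iff', mem_openConn_iff', mem_openConn_iff',
    show (openGraph ω).Reachable t x ↔ (openGraph ω).Reachable x t from ⟨SimpleGraph.Reachable.symm, SimpleGraph.Reachable.symm⟩]
  exact reachable_apex_iff hxv hxt hω

/-- `S_{w'}({ω | ω ∖ D ∈ G}ᶜ) = S_{w'}(Gᶜ)` when `w'` kills the pairs `D`. [cite: Grimmett2006, §1.4 eq. (1.20) (p. 15)] -/
theorem sum_preimageDiff_compl_dead (w' : Sym2 V → unitInterval) (q : ℝ) {u v y : V}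
    (ha : ((w' s(u, y) : unitInterval) : ℝ) = 0) (hb : ((w' s(y, v) : unitInterval) : ℝ) = 0) (G : Set (BondConfig V)) :
    ∑ ω : BondConfig V, rcWeightW w' q ∅ ω * ind {ω : BondConfig V | ω \ {s(u, y), s(y, v)} ∈ G}ᶜ ω =
      ∑ ω : BondConfig V, rcWeightW w' q ∅ ω * ind Gᶜ ω := by
  rw [← Set.univ_inter ({ω : BondConfig V | ω \ {s(u, y), s(y, v)} ∈ G}ᶜ), sum_univ_inter_preimageDiff_compl_dead w' q ha hb G]

set_option linter.unusedSimpArgs false in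
/-- **The hub inequality at `(y; x; z)` for three apexes `x, y, z` over `(u, v)` — every `0 < q ≤ 1`, any surrounding weighted
graph**: `φ_{w,q}(y ↔ x)·φ_{w,q}(z ↔ x) ≤ φ_{w,q}(y ↔ x ↔ z)` (Ayyer–Linusson–Ravichandran's (13)/(14) with all three terminals apexes).
[cite: AyyerLinussonRavichandran2025, §7 eq. (13)–(15), Conj. 7.1 (p. 22)] [cite: Grimmett2006, §3.9 (p. 63)] -/
theorem hubUnder_apex_three (w : Sym2 V → unitInterval) {q : ℝ} (hq : 0 < q) (hq1 : q ≤ 1) {u v x y z : V}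
    (hxu : x ≠ u) (hxv : x ≠ v) (hyu : y ≠ u) (hyv : y ≠ v) (hzu : z ≠ u) (hzv : z ≠ v) (hxy : x ≠ y) (hxz : x ≠ z)
    (hyz : y ≠ z) (huv : u ≠ v)
    (hwx : ∀ e : Sym2 V, x ∈ e → ((w e : unitInterval) : ℝ) ≠ 0 → u ∈ e ∨ v ∈ e)
    (hwy : ∀ e : Sym2 V, y ∈ e → ((w e : unitInterval) : ℝ) ≠ 0 → u ∈ e ∨ v ∈ e)
    (hwz : ∀ e : Sym2 V, z ∈ e → ((w e : unitInterval) : ℝ) ≠ 0 → u ∈ e ∨ v ∈ e) :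
    HubUnder (rcMeasureW w q ∅) y x z := by
  have hq0 : q ≠ 0 := hq.ne'
  -- level three: peel the hub apex `x`
  have hA := apex_mass_table w hq0 hxu hxv huv hwx (openConn y x : Set (BondConfig V))
    {ω : BondConfig V | ω \ {s(u, x), s(x, v)} ∈ ((openConn u y : Set (BondConfig V)) ∪ openConn v y : Set (BondConfig V))} {ω : BondConfig V | ω \ {s(u, x), s(x, v)} ∈ (openConn u y : Set (BondConfig V))} {ω : BondConfig V | ω \ {s(u, x), s(x, v)} ∈ (openConn v y : Set (BondConfig V))} (∅ : Set (BondConfig V))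
    (fun ω hω h1 h2 => by
      simp only [Set.mem_inter_iff, Set.mem_union, Set.mem_compl_iff, Set.mem_setOf_eq, Set.mem_univ, Set.mem_empty_iff_false, mem_openConn_apex_iff hxv hxy (apex_ae w hxu hxv hwx hω), mem_openConn_apex_iff hxv hxz (apex_ae w hxu hxv hwx hω)]
      tauto) (fun ω hω h1 h2 => by
      simp only [Set.mem_inter_iff, Set.mem_union, Set.mem_compl_iff, Set.mem_setOf_eq, Set.mem_univ, Set.mem_empty_iff_false, mem_openConn_apex_iff hxv hxy (apex_ae w hxu hxv hwx hω), mem_openConn_apex_iff hxv hxz (apex_ae w hxu hxv hwx hω)]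
      tauto) (fun ω hω h1 h2 => by
      simp only [Set.mem_inter_iff, Set.mem_union, Set.mem_compl_iff, Set.mem_setOf_eq, Set.mem_univ, Set.mem_empty_iff_false, mem_openConn_apex_iff hxv hxy (apex_ae w hxu hxv hwx hω), mem_openConn_apex_iff hxv hxz (apex_ae w hxu hxv hwx hω)]
      tauto) (fun ω hω h1 h2 => by
      simp only [Set.mem_inter_iff, Set.mem_union, Set.mem_compl_iff, Set.mem_setOf_eq, Set.mem_univ, Set.mem_empty_iff_false, mem_openConn_apex_iff hxv hxy (apex_ae w hxu hxv hwx hω), mem_openConn_apex_iff hxv hxz (apex_ae w hxu hxv hwx hω)]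
      tauto)
    (diffApex_insens u v x ((openConn u y : Set (BondConfig V)) ∪ openConn v y : Set (BondConfig V)) (Or.inl rfl)) (diffApex_insens u v x ((openConn u y : Set (BondConfig V)) ∪ openConn v y : Set (BondConfig V)) (Or.inr rfl)) (diffApex_insens u v x (openConn u y : Set (BondConfig V)) (Or.inl rfl)) (diffApex_insens u v x (openConn v y : Set (BondConfig V)) (Or.inr rfl))
  have hB := apex_mass_table w hq0 hxu hxv huv hwx (openConn z x : Set (BondConfig V))
    {ω : BondConfig V | ω \ {s(u, x), s(x, v)} ∈ ((openConn u z : Set (BondConfig V)) ∪ openConn v z : Set (BondConfig V))} {ω : BondConfig V | ω \ {s(u, x), s(x, v)} ∈ (openConn u z : Set (BondConfig V))} {ω : BondConfig V | ω \ {s(u, x), s(x, v)} ∈ (openConn v z : Set (BondConfig V))} (∅ : Set (BondConfig V))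
    (fun ω hω h1 h2 => by
      simp only [Set.mem_inter_iff, Set.mem_union, Set.mem_compl_iff, Set.mem_setOf_eq, Set.mem_univ, Set.mem_empty_iff_false, mem_openConn_apex_iff hxv hxy (apex_ae w hxu hxv hwx hω), mem_openConn_apex_iff hxv hxz (apex_ae w hxu hxv hwx hω)]
      tauto) (fun ω hω h1 h2 => by
      simp only [Set.mem_inter_iff, Set.mem_union, Set.mem_compl_iff, Set.mem_setOf_eq, Set.mem_univ, Set.mem_empty_iff_false, mem_openConn_apex_iff hxv hxy (apex_ae w hxu hxv hwx hω), mem_openConn_apex_iff hxv hxz (apex_ae w hxu hxv hwx hω)]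
      tauto) (fun ω hω h1 h2 => by
      simp only [Set.mem_inter_iff, Set.mem_union, Set.mem_compl_iff, Set.mem_setOf_eq, Set.mem_univ, Set.mem_empty_iff_false, mem_openConn_apex_iff hxv hxy (apex_ae w hxu hxv hwx hω), mem_openConn_apex_iff hxv hxz (apex_ae w hxu hxv hwx hω)]
      tauto) (fun ω hω h1 h2 => by
      simp only [Set.mem_inter_iff, Set.mem_union, Set.mem_compl_iff, Set.mem_setOf_eq, Set.mem_univ, Set.mem_empty_iff_false, mem_openConn_apex_iff hxv hxy (apex_ae w hxu hxv hwx hω), mem_openConn_apex_iff hxv hxz (apex_ae w hxu hxv hwx hω)]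
      tauto)
    (diffApex_insens u v x ((openConn u z : Set (BondConfig V)) ∪ openConn v z : Set (BondConfig V)) (Or.inl rfl)) (diffApex_insens u v x ((openConn u z : Set (BondConfig V)) ∪ openConn v z : Set (BondConfig V)) (Or.inr rfl)) (diffApex_insens u v x (openConn u z : Set (BondConfig V)) (Or.inl rfl)) (diffApex_insens u v x (openConn v z : Set (BondConfig V)) (Or.inr rfl))
  have hAB := apex_mass_table w hq0 hxu hxv huv hwx ((openConn y x : Set (BondConfig V)) ∩ openConn z x)
    {ω : BondConfig V | ω \ {s(u, x), s(x, v)} ∈ (((openConn u y : Set (BondConfig V)) ∪ openConn v y) ∩ ((openConn u z : Set (BondConfig V)) ∪ openConn v z) : Set (BondConfig V))} {ω : BondConfig V | ω \ {s(u, x), s(x, v)} ∈ ((openConn u y : Set (BondConfig V)) ∩ openConn u z : Set (BondConfig V))} {ω : BondConfig V | ω \ {s(u, x), s(x, v)} ∈ ((openConn v y : Set (BondConfig V)) ∩ openConn v z : Set (BondConfig V))} (∅ : Set (BondConfig V))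
    (fun ω hω h1 h2 => by
      simp only [Set.mem_inter_iff, Set.mem_union, Set.mem_compl_iff, Set.mem_setOf_eq, Set.mem_univ, Set.mem_empty_iff_false, mem_openConn_apex_iff hxv hxy (apex_ae w hxu hxv hwx hω), mem_openConn_apex_iff hxv hxz (apex_ae w hxu hxv hwx hω)]
      tauto) (fun ω hω h1 h2 => by
      simp only [Set.mem_inter_iff, Set.mem_union, Set.mem_compl_iff, Set.mem_setOf_eq, Set.mem_univ, Set.mem_empty_iff_false, mem_openConn_apex_iff hxv hxy (apex_ae w hxu hxv hwx hω), mem_openConn_apex_iff hxv hxz (apex_ae w hxu hxv hwx hω)]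
      tauto) (fun ω hω h1 h2 => by
      simp only [Set.mem_inter_iff, Set.mem_union, Set.mem_compl_iff, Set.mem_setOf_eq, Set.mem_univ, Set.mem_empty_iff_false, mem_openConn_apex_iff hxv hxy (apex_ae w hxu hxv hwx hω), mem_openConn_apex_iff hxv hxz (apex_ae w hxu hxv hwx hω)]
      tauto) (fun ω hω h1 h2 => by
      simp only [Set.mem_inter_iff, Set.mem_union, Set.mem_compl_iff, Set.mem_setOf_eq, Set.mem_univ, Set.mem_empty_iff_false, mem_openConn_apex_iff hxv hxy (apex_ae w hxu hxv hwx hω), mem_openConn_apex_iff hxv hxz (apex_ae w hxu hxv hwx hω)]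
      tauto)
    (diffApex_insens u v x (((openConn u y : Set (BondConfig V)) ∪ openConn v y) ∩ ((openConn u z : Set (BondConfig V)) ∪ openConn v z) : Set (BondConfig V)) (Or.inl rfl)) (diffApex_insens u v x (((openConn u y : Set (BondConfig V)) ∪ openConn v y) ∩ ((openConn u z : Set (BondConfig V)) ∪ openConn v z) : Set (BondConfig V)) (Or.inr rfl)) (diffApex_insens u v x ((openConn u y : Set (BondConfig V)) ∩ openConn u z : Set (BondConfig V)) (Or.inl rfl)) (diffApex_insens u v x ((openConn v y : Set (BondConfig V)) ∩ openConn v z : Set (BondConfig V)) (Or.inr rfl))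
  have hZ := apex_mass_table w hq0 hxu hxv huv hwx Set.univ Set.univ Set.univ Set.univ Set.univ
    (fun _ _ _ _ => Iff.rfl) (fun _ _ _ _ => Iff.rfl) (fun _ _ _ _ => Iff.rfl) (fun _ _ _ _ => Iff.rfl)
    (univ_insens _) (univ_insens _) (univ_insens _) (univ_insens _)
  -- read the auxiliary events under `w[ux, xv ↦ 0]`
  have hda := apexDead_fst w hxu huv
  have hdb := apexDead_snd w u v x
  rw [sum_preimageDiff_inter_compl_dead _ q hda hdb ((openConn u y : Set (BondConfig V)) ∪ openConn v y) (openConn u v), sum_preimageDiff_dead _ q hda hdb ((openConn u y : Set (BondConfig V)) ∪ openConn v y),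
    sum_preimageDiff_dead _ q hda hdb (openConn u y : Set (BondConfig V)), sum_preimageDiff_dead _ q hda hdb (openConn v y : Set (BondConfig V))] at hA
  rw [sum_preimageDiff_inter_compl_dead _ q hda hdb ((openConn u z : Set (BondConfig V)) ∪ openConn v z) (openConn u v), sum_preimageDiff_dead _ q hda hdb ((openConn u z : Set (BondConfig V)) ∪ openConn v z),
    sum_preimageDiff_dead _ q hda hdb (openConn u z : Set (BondConfig V)), sum_preimageDiff_dead _ q hda hdb (openConn v z : Set (BondConfig V))] at hB
  rw [sum_preimageDiff_inter_compl_dead _ q hda hdb (((openConn u y : Set (BondConfig V)) ∪ openConn v y) ∩ ((openConn u z : Set (BondConfig V)) ∪ openConn v z)) (openConn u v), sum_preimageDiff_dead _ q hda hdb (((openConn u y : Set (BondConfig V)) ∪ openConn v y) ∩ ((openConn u z : Set (BondConfig V)) ∪ openConn v z)),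
    sum_preimageDiff_dead _ q hda hdb ((openConn u y : Set (BondConfig V)) ∩ openConn u z), sum_preimageDiff_dead _ q hda hdb ((openConn v y : Set (BondConfig V)) ∩ openConn v z)] at hAB
  rw [sum_univ_inter_preimageDiff_compl_dead _ q hda hdb (openConn u v)] at hZ
  -- level two: `y` and `z` are apexes under `w[ux, xv ↦ 0]`
  have hwy' : ∀ e : Sym2 V, y ∈ e → (((Function.update (Function.update w s(u, x) 0) s(x, v) 0) e : unitInterval) : ℝ) ≠ 0 → u ∈ e ∨ v ∈ e :=
    apex_hyp_update (apex_hyp_update hwy s(u, x) (fun _ => Or.inl (Sym2.mem_mk_left u x)) 0) s(x, v)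
      (fun _ => Or.inr (Sym2.mem_mk_right x v)) 0
  have hwz' : ∀ e : Sym2 V, z ∈ e → (((Function.update (Function.update w s(u, x) 0) s(x, v) 0) e : unitInterval) : ℝ) ≠ 0 → u ∈ e ∨ v ∈ e :=
    apex_hyp_update (apex_hyp_update hwz s(u, x) (fun _ => Or.inl (Sym2.mem_mk_left u x)) 0) s(x, v)
      (fun _ => Or.inr (Sym2.mem_mk_right x v)) 0
  have hZy := apexForm_univ (Function.update (Function.update w s(u, x) 0) s(x, v) 0) hq0 hyu hyv huv hwy'
  have hUV2 := apexForm_uv (Function.update (Function.update w s(u, x) 0) s(x, v) 0) hq0 hyu hyv huv hwy'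
  have hUY2 := apexForm_uy (Function.update (Function.update w s(u, x) 0) s(x, v) 0) hq0 hyu hyv huv hwy'
  have hVY2 := apexForm_vy (Function.update (Function.update w s(u, x) 0) s(x, v) 0) hq0 hyu hyv huv hwy'
  have hATTY := apexForm_att (Function.update (Function.update w s(u, x) 0) s(x, v) 0) hq0 hyu hyv huv hwy'
  have hSEPY := apexForm_att_sep (Function.update (Function.update w s(u, x) 0) s(x, v) 0) hq0 hyu hyv huv hwy'
  have hUZ2 := apexForm2_uz (Function.update (Function.update w s(u, x) 0) s(x, v) 0) hq0 hyu hyv hyz.symm huv hwy'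
  have hVZ2 := apexForm2_vz (Function.update (Function.update w s(u, x) 0) s(x, v) 0) hq0 hyu hyv hyz.symm huv hwy'
  have hATTZ := apexForm2_attz (Function.update (Function.update w s(u, x) 0) s(x, v) 0) hq0 hyu hyv hyz.symm huv hwy'
  have hSEPZ := apexForm2_sepz (Function.update (Function.update w s(u, x) 0) s(x, v) 0) hq0 hyu hyv hyz.symm huv hwy'
  have hBOTH := apexForm2_both (Function.update (Function.update w s(u, x) 0) s(x, v) 0) hq0 hyu hyv hyz.symm huv hwy'
  have hBSEP := apexForm2_bsep (Function.update (Function.update w s(u, x) 0) s(x, v) 0) hq0 hyu hyv hyz.symm huv hwy'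
  have hUU2 := apexForm2_uu (Function.update (Function.update w s(u, x) 0) s(x, v) 0) hq0 hyu hyv hyz.symm huv hwy'
  have hVV2 := apexForm2_vv (Function.update (Function.update w s(u, x) 0) s(x, v) 0) hq0 hyu hyv hyz.symm huv hwy'
  -- read the `y`-auxiliary events under `w[ux, xv, uy, yv ↦ 0]`
  have hda2 := apexDead_fst (Function.update (Function.update w s(u, x) 0) s(x, v) 0) hyu huv
  have hdb2 := apexDead_snd (Function.update (Function.update w s(u, x) 0) s(x, v) 0) u v y
  have cK := sum_preimageDiff_dead _ q hda2 hdb2 (openConn u v : Set (BondConfig V))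
  have cKc := sum_preimageDiff_compl_dead _ q hda2 hdb2 (openConn u v : Set (BondConfig V))
  rw [cKc] at hZy
  rw [cKc, cK] at hUV2
  rw [cKc, cK] at hUY2
  rw [cKc, cK] at hVY2
  rw [cKc] at hATTY
  rw [cKc] at hSEPY
  -- level one: `z` is an apex under `w[ux, xv, uy, yv ↦ 0]`
  have hwz'' : ∀ e : Sym2 V, z ∈ e → (((Function.update (Function.update (Function.update (Function.update w s(u, x) 0) s(x, v) 0) s(u, y) 0) s(y, v) 0) e : unitInterval) : ℝ) ≠ 0 → u ∈ e ∨ v ∈ e :=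
    apex_hyp_update (apex_hyp_update hwz' s(u, y) (fun _ => Or.inl (Sym2.mem_mk_left u y)) 0) s(y, v)
      (fun _ => Or.inr (Sym2.mem_mk_right y v)) 0
  have hZz := apexForm_univ (Function.update (Function.update (Function.update (Function.update w s(u, x) 0) s(x, v) 0) s(u, y) 0) s(y, v) 0) hq0 hzu hzv huv hwz''
  have hUVz := apexForm_uv (Function.update (Function.update (Function.update (Function.update w s(u, x) 0) s(x, v) 0) s(u, y) 0) s(y, v) 0) hq0 hzu hzv huv hwz''
  have hUZ := apexForm_uy (Function.update (Function.update (Function.update (Function.update w s(u, x) 0) s(x, v) 0) s(u, y) 0) s(y, v) 0) hq0 hzu hzv huv hwz''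
  have hVZ := apexForm_vy (Function.update (Function.update (Function.update (Function.update w s(u, x) 0) s(x, v) 0) s(u, y) 0) s(y, v) 0) hq0 hzu hzv huv hwz''
  have hATTz := apexForm_att (Function.update (Function.update (Function.update (Function.update w s(u, x) 0) s(x, v) 0) s(u, y) 0) s(y, v) 0) hq0 hzu hzv huv hwz''
  have hSEPz := apexForm_att_sep (Function.update (Function.update (Function.update (Function.update w s(u, x) 0) s(x, v) 0) s(u, y) 0) s(y, v) 0) hq0 hzu hzv huv hwz''
  have hUVVZ := apexForm_uv_vy (Function.update (Function.update (Function.update (Function.update w s(u, x) 0) s(x, v) 0) s(u, y) 0) s(y, v) 0) hq0 hzu hzv huv hwz''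
  have hUVUZ := apexForm_uv_uy (Function.update (Function.update (Function.update (Function.update w s(u, x) 0) s(x, v) 0) s(u, y) 0) s(y, v) 0) hq0 hzu hzv huv hwz''
  have hsplit := sum_rcWeightW_ind_univ_eq_add (Function.update (Function.update (Function.update (Function.update (Function.update (Function.update w s(u, x) 0) s(x, v) 0) s(u, y) 0) s(y, v) 0) s(u, z) 0) s(z, v) 0) q
    {ω : BondConfig V | ω \ {s(u, z), s(z, v)} ∈ (openConn u v : Set (BondConfig V))}
  rw [hsplit] at hZz hUVz hUZ hVZ hATTz hUVVZ hUVUZ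
  -- the complement and empty masses
  have hKcz : ∑ ω : BondConfig V, rcWeightW (Function.update (Function.update (Function.update (Function.update w s(u, x) 0) s(x, v) 0) s(u, y) 0) s(y, v) 0) q ∅ ω * ind (openConn u v : Set (BondConfig V))ᶜ ω =
      ∑ ω : BondConfig V, rcWeightW (Function.update (Function.update (Function.update (Function.update w s(u, x) 0) s(x, v) 0) s(u, y) 0) s(y, v) 0) q ∅ ω * ind (Set.univ : Set (BondConfig V)) ω - ∑ ω : BondConfig V, rcWeightW (Function.update (Function.update (Function.update (Function.update w s(u, x) 0) s(x, v) 0) s(u, y) 0) s(y, v) 0) q ∅ ω * ind (openConn u v : Set (BondConfig V)) ω := by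
    rw [sum_rcWeightW_ind_compl, sum_rcWeightW_ind_univ]
  have hKc2 : ∑ ω : BondConfig V, rcWeightW (Function.update (Function.update w s(u, x) 0) s(x, v) 0) q ∅ ω * ind (openConn u v : Set (BondConfig V))ᶜ ω =
      ∑ ω : BondConfig V, rcWeightW (Function.update (Function.update w s(u, x) 0) s(x, v) 0) q ∅ ω * ind (Set.univ : Set (BondConfig V)) ω - ∑ ω : BondConfig V, rcWeightW (Function.update (Function.update w s(u, x) 0) s(x, v) 0) q ∅ ω * ind (openConn u v : Set (BondConfig V)) ω := by
    rw [sum_rcWeightW_ind_compl, sum_rcWeightW_ind_univ]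
  have hE1 : ∑ ω : BondConfig V, rcWeightW (Function.update (Function.update (Function.update (Function.update w s(u, x) 0) s(x, v) 0) s(u, y) 0) s(y, v) 0) q ∅ ω * ind (∅ : Set (BondConfig V)) ω = 0 := sum_rcWeightW_ind_empty _ q
  have hE2 : ∑ ω : BondConfig V, rcWeightW (Function.update (Function.update w s(u, x) 0) s(x, v) 0) q ∅ ω * ind (∅ : Set (BondConfig V)) ω = 0 := sum_rcWeightW_ind_empty _ q
  -- signs and the three leaf relations
  have ha₁ : 0 ≤ ((w s(u, x) : unitInterval) : ℝ) := (w s(u, x)).2.1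
  have ha₁' : 0 ≤ 1 - ((w s(u, x) : unitInterval) : ℝ) := sub_nonneg.2 (w s(u, x)).2.2
  have hb₁ : 0 ≤ ((w s(x, v) : unitInterval) : ℝ) := (w s(x, v)).2.1
  have hb₁' : 0 ≤ 1 - ((w s(x, v) : unitInterval) : ℝ) := sub_nonneg.2 (w s(x, v)).2.2
  have ha₂ : 0 ≤ (((Function.update (Function.update w s(u, x) 0) s(x, v) 0) s(u, y) : unitInterval) : ℝ) := ((Function.update (Function.update w s(u, x) 0) s(x, v) 0) s(u, y)).2.1
  have ha₂' : 0 ≤ 1 - (((Function.update (Function.update w s(u, x) 0) s(x, v) 0) s(u, y) : unitInterval) : ℝ) := sub_nonneg.2 ((Function.update (Function.update w s(u, x) 0) s(x, v) 0) s(u, y)).2.2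
  have hb₂ : 0 ≤ (((Function.update (Function.update w s(u, x) 0) s(x, v) 0) s(y, v) : unitInterval) : ℝ) := ((Function.update (Function.update w s(u, x) 0) s(x, v) 0) s(y, v)).2.1
  have hb₂' : 0 ≤ 1 - (((Function.update (Function.update w s(u, x) 0) s(x, v) 0) s(y, v) : unitInterval) : ℝ) := sub_nonneg.2 ((Function.update (Function.update w s(u, x) 0) s(x, v) 0) s(y, v)).2.2
  have ha₃ : 0 ≤ (((Function.update (Function.update (Function.update (Function.update w s(u, x) 0) s(x, v) 0) s(u, y) 0) s(y, v) 0) s(u, z) : unitInterval) : ℝ) := ((Function.update (Function.update (Function.update (Function.update w s(u, x) 0) s(x, v) 0) s(u, y) 0) s(y, v) 0) s(u, z)).2.1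
  have ha₃' : 0 ≤ 1 - (((Function.update (Function.update (Function.update (Function.update w s(u, x) 0) s(x, v) 0) s(u, y) 0) s(y, v) 0) s(u, z) : unitInterval) : ℝ) := sub_nonneg.2 ((Function.update (Function.update (Function.update (Function.update w s(u, x) 0) s(x, v) 0) s(u, y) 0) s(y, v) 0) s(u, z)).2.2
  have hb₃ : 0 ≤ (((Function.update (Function.update (Function.update (Function.update w s(u, x) 0) s(x, v) 0) s(u, y) 0) s(y, v) 0) s(z, v) : unitInterval) : ℝ) := ((Function.update (Function.update (Function.update (Function.update w s(u, x) 0) s(x, v) 0) s(u, y) 0) s(y, v) 0) s(z, v)).2.1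
  have hb₃' : 0 ≤ 1 - (((Function.update (Function.update (Function.update (Function.update w s(u, x) 0) s(x, v) 0) s(u, y) 0) s(y, v) 0) s(z, v) : unitInterval) : ℝ) := sub_nonneg.2 ((Function.update (Function.update (Function.update (Function.update w s(u, x) 0) s(x, v) 0) s(u, y) 0) s(y, v) 0) s(z, v)).2.2
  have hr : 0 ≤ q⁻¹ := inv_nonneg.2 hq.le
  have hs : 0 ≤ q⁻¹ - 1 := sub_nonneg.2 ((one_le_inv₀ hq).2 hq1)
  have hrel₁ : ((w s(u, x) : unitInterval) : ℝ) * (1 - ((w s(x, v) : unitInterval) : ℝ)) * q⁻¹ * ((1 - ((w s(u, x) : unitInterval) : ℝ)) * ((w s(x, v) : unitInterval) : ℝ) * q⁻¹) =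
      ((w s(u, x) : unitInterval) : ℝ) * ((w s(x, v) : unitInterval) : ℝ) * q⁻¹ * ((1 - ((w s(u, x) : unitInterval) : ℝ)) * (1 - ((w s(x, v) : unitInterval) : ℝ))) * (1 + (q⁻¹ - 1)) := by ring
  have hrel₂ : (((Function.update (Function.update w s(u, x) 0) s(x, v) 0) s(u, y) : unitInterval) : ℝ) * (1 - (((Function.update (Function.update w s(u, x) 0) s(x, v) 0) s(y, v) : unitInterval) : ℝ)) * q⁻¹ * ((1 - (((Function.update (Function.update w s(u, x) 0) s(x, v) 0) s(u, y) : unitInterval) : ℝ)) * (((Function.update (Function.update w s(u, x) 0) s(x, v) 0) s(y, v) : unitInterval) : ℝ) * q⁻¹) =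
      (((Function.update (Function.update w s(u, x) 0) s(x, v) 0) s(u, y) : unitInterval) : ℝ) * (((Function.update (Function.update w s(u, x) 0) s(x, v) 0) s(y, v) : unitInterval) : ℝ) * q⁻¹ * ((1 - (((Function.update (Function.update w s(u, x) 0) s(x, v) 0) s(u, y) : unitInterval) : ℝ)) * (1 - (((Function.update (Function.update w s(u, x) 0) s(x, v) 0) s(y, v) : unitInterval) : ℝ))) * (1 + (q⁻¹ - 1)) := by ring
  have hrel₃ : (((Function.update (Function.update (Function.update (Function.update w s(u, x) 0) s(x, v) 0) s(u, y) 0) s(y, v) 0) s(u, z) : unitInterval) : ℝ) * (1 - (((Function.update (Function.update (Function.update (Function.update w s(u, x) 0) s(x, v) 0) s(u, y) 0) s(y, v) 0) s(z, v) : unitInterval) : ℝ)) * q⁻¹ * ((1 - (((Function.update (Function.update (Function.update (Function.update w s(u, x) 0) s(x, v) 0) s(u, y) 0) s(y, v) 0) s(u, z) : unitInterval) : ℝ)) * (((Function.update (Function.update (Function.update (Function.update w s(u, x) 0) s(x, v) 0) s(u, y) 0) s(y, v) 0) s(z, v) : unitInterval) : ℝ) * q⁻¹) =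
      (((Function.update (Function.update (Function.update (Function.update w s(u, x) 0) s(x, v) 0) s(u, y) 0) s(y, v) 0) s(u, z) : unitInterval) : ℝ) * (((Function.update (Function.update (Function.update (Function.update w s(u, x) 0) s(x, v) 0) s(u, y) 0) s(y, v) 0) s(z, v) : unitInterval) : ℝ) * q⁻¹ * ((1 - (((Function.update (Function.update (Function.update (Function.update w s(u, x) 0) s(x, v) 0) s(u, y) 0) s(y, v) 0) s(u, z) : unitInterval) : ℝ)) * (1 - (((Function.update (Function.update (Function.update (Function.update w s(u, x) 0) s(x, v) 0) s(u, y) 0) s(y, v) 0) s(z, v) : unitInterval) : ℝ))) * (1 + (q⁻¹ - 1)) := by ring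
  have hA0 := sum_rcWeightW_ind_nonneg (Function.update (Function.update (Function.update (Function.update (Function.update (Function.update w s(u, x) 0) s(x, v) 0) s(u, y) 0) s(y, v) 0) s(u, z) 0) s(z, v) 0) hq.le
    {ω : BondConfig V | ω \ {s(u, z), s(z, v)} ∈ (openConn u v : Set (BondConfig V))}
  have hB0 := sum_rcWeightW_ind_nonneg (Function.update (Function.update (Function.update (Function.update (Function.update (Function.update w s(u, x) 0) s(x, v) 0) s(u, y) 0) s(y, v) 0) s(u, z) 0) s(z, v) 0) hq.le
    {ω : BondConfig V | ω \ {s(u, z), s(z, v)} ∈ (openConn u v : Set (BondConfig V))}ᶜ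
  -- assemble
  unfold HubUnder
  apply real_mul_le_of_mass w hq
  rw [← sum_rcWeightW_ind_univ w q]
  exact apexThree_alg (mul_nonneg ha₁' hb₁') (mul_nonneg (mul_nonneg ha₁ hb₁') hr) (mul_nonneg (mul_nonneg ha₁' hb₁) hr)
    (mul_nonneg (mul_nonneg ha₁ hb₁) hr) (mul_nonneg ha₂' hb₂') (mul_nonneg (mul_nonneg ha₂ hb₂') hr)
    (mul_nonneg (mul_nonneg ha₂' hb₂) hr) (mul_nonneg (mul_nonneg ha₂ hb₂) hr) (mul_nonneg ha₃' hb₃')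
    (mul_nonneg (mul_nonneg ha₃ hb₃') hr) (mul_nonneg (mul_nonneg ha₃' hb₃) hr) (mul_nonneg (mul_nonneg ha₃ hb₃) hr) hs hA0 hB0
    hrel₁ hrel₂ hrel₃ hZz hUVz hUZ hVZ hATTz hSEPz hUVVZ hUVUZ hKcz hE1 hZy hUV2 hUY2 hVY2 hATTY hSEPY hUZ2 hVZ2 hATTZ hSEPZ
    hBOTH hBSEP hUU2 hVV2 hKc2 hE2 hA hB hAB hZ

end FK

end Summit.CriticalPhenomena.PercolationContinuityZ3.Theorems

end
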